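import Summits.Ventures.LatticeQCDFlow.Exactness.IMHCoupledEstimatorBernstein
import HarnessLib

/-!
# Anytime-valid Hoeffding and Bernstein error bars for running averages: optional continuation is honest once the risk is
# spread over a summable schedule, `P(∃ R ≥ 1, |X̄_R − m| ≥ ε_R) ≤ Σ_R δ_R`

HONEST FRAMING: exact (Metropolis-corrected) sampling algorithms for lattice gauge theory;
figures of merit are autocorrelation/cost numbers at stated couplings and volumes; no
continuum-physics claim.

Venture `LatticeQCDFlow` (cell pub-lqcd), topic `Exactness`; FANOUT row 30 (lean-1, GEN-41).  NEW WORK of the cell, generic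
probability over Mathlib (Hoeffding through `HasSubgaussianMGF`, as applied in GEN-39's `Exactness/IMHCoupledEstimatorHoeffding`;
Bernstein from GEN-40's `Exactness/BernsteinInequality`).  Every certified error bar of the coupled flow-MCMC estimator landed so far
(`IMHCoupledEstimator{Hoeffding, BurnInHoeffding, Bernstein, …}`) is a statement at a FIXED number `R` of replicas.  In practice the
number of replicas is not fixed in advance: one adds replicas until the printed bar is below tolerance, or keeps a run going and
reads the bar repeatedly — and a fixed-`R` bar read at a data-dependent `R` is no longer a certificate.  The repair is elementary
and is typed here once, for re-use by the IMH files: spread the risk `δ` over the sample sizes by a summable schedule `δ_R` and take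
the union bound over `R` (the "stitched" confidence sequence; printed counterpart NAMED ONLY: Howard, Ramdas, McAuliffe, Sekhon,
*Time-uniform, nonparametric, nonasymptotic confidence sequences*, Ann. Statist. 49 (2021), §1's stitching; Darling–Robbins 1967).

## Content (a probability space `(Ω', μ)`; `X_0, X_1, …` mutually independent real random variables with a common mean `m`)

* §1 the schedule: `hasSum_one_div_succ_mul_succ_succ` — `Σ_{R≥0} 1/((R + 1)(R + 2)) = 1` (telescoping); `hasSum_schedule`,
  `summable_schedule`, `tsum_schedule` — `Σ_R δ/((R + 1)(R + 2)) = δ`; `schedule_nonneg`, `schedule_pos`.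
* §2 `measureReal_iUnion_le_tsum` — the countable union bound in `ℝ`: `μ(⋃_R E_R) ≤ Σ_R b_R` when `μ(E_R) ≤ b_R`, `b` summable;
  `setOf_exists_ge_one_eq_iUnion` [bookkeeping].
* §3 **`hoeffding_avg_abs_anytime`** — ANYTIME HOEFFDING: `X_j ∈ [a, b]`; for every radius sequence `ε_R ≥ 0` and risk schedule
  `δ_R ≥ 0` with `2·exp(−2Rε_R²/(b − a)²) ≤ δ_R` (`R ≥ 1`) and `δ` summable,
  `P(∃ R ≥ 1, |R⁻¹Σ_{j<R} X_j − m| ≥ ε_R) ≤ Σ_R δ_R`;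
  **`hoeffding_avg_abs_anytime_of_log_le`** — the calibrated form: if `(b − a)²·log(4(R + 1)(R + 2)/δ) ≤ 2Rε_R²` for every `R ≥ 1`
  then `P(∃ R ≥ 1, |X̄_R − m| ≥ ε_R) ≤ δ/2` — the price of validity at EVERY sample size is the factor `(R + 1)(R + 2)` inside the
  logarithm, i.e. a radius `ε_R = (b − a)·√(log(4(R + 1)(R + 2)/δ)/(2R))` in place of `(b − a)·√(log(4/δ)/(2R))`.
* §4 **`bernstein_avg_abs_anytime`**, **`bernstein_avg_abs_anytime_of_log_le`** — the same for Bernstein's inequality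
  (`|X_j − m| ≤ b`, `Var X_j ≤ σ²`): `2·exp(−Rε_R²/(2(σ² + bε_R/3))) ≤ δ_R` for `R ≥ 1` ⇒ `P(∃ R ≥ 1, |X̄_R − m| ≥ ε_R) ≤ Σ_R δ_R`, and
  `2(σ² + bε_R/3)·log(4(R + 1)(R + 2)/δ) ≤ Rε_R²` for every `R ≥ 1` ⇒ `≤ δ/2`.
Reading: an error bar that is valid simultaneously at every number of replicas may be read, and the sampling stopped or continued,
at any data-dependent time without losing its meaning; the cost against the fixed-`R` bar is logarithmic in `R`.
NOT CLAIMED: the law-of-the-iterated-logarithm rate (finer stitching over geometric epochs), martingale (Ville) confidence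
sequences, anything about Markov chains (the IMH application is the sequel).  No `sorry`, no new definitions, nothing cited as a fact.
-/

noncomputable section

namespace Summit.Ventures.LatticeQCDFlow.Exactness

open MeasureTheory ProbabilityTheory Function Finset Filter
open scoped ENNReal NNReal Topology

/-! ## §1 The risk schedule `δ_R = δ/((R + 1)(R + 2))` -/

/-- `Σ_{R<n} 1/((R + 1)(R + 2)) = 1 − 1/(n + 1)` (telescoping). [ours, bookkeeping] -/
theorem sum_range_one_div_succ_mul_succ_succ (n : ℕ) :
    ∑ R ∈ range n, 1 / (((R : ℝ) + 1) * ((R : ℝ) + 2)) = 1 - 1 / ((n : ℝ) + 1) := by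
  induction n with
  | zero => simp
  | succ n ih =>
    rw [sum_range_succ, ih, Nat.cast_succ]
    have h1 : (n : ℝ) + 1 ≠ 0 := by positivity
    have h2 : (n : ℝ) + 1 + 1 ≠ 0 := by positivity
    have h3 : (n : ℝ) + 2 ≠ 0 := by positivity
    field_simp
    ring

/-- **`Σ_{R≥0} 1/((R + 1)(R + 2)) = 1`.** [folklore] -/
theorem hasSum_one_div_succ_mul_succ_succ : HasSum (fun R : ℕ => 1 / (((R : ℝ) + 1) * ((R : ℝ) + 2))) 1 := by
  rw [hasSum_iff_tendsto_nat_of_nonneg (fun R => by positivity)]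
  have h : Tendsto (fun n : ℕ => (1 : ℝ) - 1 / ((n : ℝ) + 1)) atTop (𝓝 (1 - 0)) :=
    tendsto_const_nhds.sub tendsto_one_div_add_atTop_nhds_zero_nat
  rw [sub_zero] at h
  exact h.congr fun n => (sum_range_one_div_succ_mul_succ_succ n).symm

/-- The schedule `δ/((R + 1)(R + 2))` sums to `δ`. [ours, bookkeeping] -/
theorem hasSum_schedule (δ : ℝ) : HasSum (fun R : ℕ => δ / (((R : ℝ) + 1) * ((R : ℝ) + 2))) δ := by
  have h := hasSum_one_div_succ_mul_succ_succ.mul_left δ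
  simp only [mul_one_div, mul_one] at h
  exact h

/-- The schedule is summable. [ours, bookkeeping] -/
theorem summable_schedule (δ : ℝ) : Summable (fun R : ℕ => δ / (((R : ℝ) + 1) * ((R : ℝ) + 2))) :=
  (hasSum_schedule δ).summable

/-- `Σ_R δ/((R + 1)(R + 2)) = δ`. [ours, bookkeeping] -/
theorem tsum_schedule (δ : ℝ) : ∑' R : ℕ, δ / (((R : ℝ) + 1) * ((R : ℝ) + 2)) = δ :=
  (hasSum_schedule δ).tsum_eq

/-- The schedule is non-negative for `δ ≥ 0`. [ours, bookkeeping] -/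
theorem schedule_nonneg {δ : ℝ} (hδ : 0 ≤ δ) (R : ℕ) : 0 ≤ δ / (((R : ℝ) + 1) * ((R : ℝ) + 2)) := by positivity

/-- The schedule is positive for `δ > 0`. [ours, bookkeeping] -/
theorem schedule_pos {δ : ℝ} (hδ : 0 < δ) (R : ℕ) : 0 < δ / (((R : ℝ) + 1) * ((R : ℝ) + 2)) := by positivity

/-- `4/(δ/((R + 1)(R + 2))) = 4(R + 1)(R + 2)/δ`. [ours, bookkeeping] -/
theorem four_div_schedule (δ : ℝ) (R : ℕ) :
    4 / (δ / (((R : ℝ) + 1) * ((R : ℝ) + 2))) = 4 * (((R : ℝ) + 1) * ((R : ℝ) + 2)) / δ := by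
  rw [div_div_eq_mul_div, mul_comm]

/-! ## §2 The countable union bound with a summable schedule -/

section Generic

variable {Ω' : Type*} {mΩ' : MeasurableSpace Ω'} {μ : Measure Ω'}

/-- **`μ(⋃_R E_R) ≤ Σ_R b_R`** in `ℝ`, for a finite measure, when `μ(E_R) ≤ b_R` for every `R` and `b` is summable. [folklore] -/
theorem measureReal_iUnion_le_tsum [IsFiniteMeasure μ] {E : ℕ → Set Ω'} {b : ℕ → ℝ} (hb : ∀ R, μ.real (E R) ≤ b R)
    (hs : Summable b) : μ.real (⋃ R, E R) ≤ ∑' R, b R := by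
  have hb0 : ∀ R, 0 ≤ b R := fun R => measureReal_nonneg.trans (hb R)
  have hE : ∀ R, μ (E R) ≤ ENNReal.ofReal (b R) := fun R =>
    (ENNReal.le_ofReal_iff_toReal_le (measure_ne_top μ _) (hb0 R)).2 (hb R)
  have h1 : μ (⋃ R, E R) ≤ ENNReal.ofReal (∑' R, b R) :=
    calc μ (⋃ R, E R) ≤ ∑' R, μ (E R) := measure_iUnion_le _
      _ ≤ ∑' R, ENNReal.ofReal (b R) := ENNReal.tsum_le_tsum hE
      _ = ENNReal.ofReal (∑' R, b R) := (ENNReal.ofReal_tsum_of_nonneg hb0 hs).symm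
  exact ENNReal.toReal_le_of_le_ofReal (tsum_nonneg hb0) h1

omit mΩ' in
/-- `{ω | ∃ R ≥ 1, P R ω} = ⋃_R {ω | 1 ≤ R ∧ P R ω}`. [ours, bookkeeping] -/
theorem setOf_exists_ge_one_eq_iUnion (P : ℕ → Ω' → Prop) :
    {ω | ∃ R, 1 ≤ R ∧ P R ω} = ⋃ R, {ω | 1 ≤ R ∧ P R ω} := by
  ext ω; simp only [Set.mem_setOf_eq, Set.mem_iUnion]

/-- The union bound over the sample sizes `R ≥ 1`: if `μ{1 ≤ R ∧ P_R} ≤ δ_R` for `R ≥ 1`, `δ ≥ 0` summable, then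
`μ{∃ R ≥ 1, P_R} ≤ Σ_R δ_R`. [ours, bookkeeping] -/
theorem measureReal_exists_ge_one_le_tsum [IsFiniteMeasure μ] {P : ℕ → Ω' → Prop} {δ : ℕ → ℝ} (hδ0 : ∀ R, 0 ≤ δ R)
    (hP : ∀ R, 1 ≤ R → μ.real {ω | P R ω} ≤ δ R) (hs : Summable δ) :
    μ.real {ω | ∃ R, 1 ≤ R ∧ P R ω} ≤ ∑' R, δ R := by
  rw [setOf_exists_ge_one_eq_iUnion]
  refine measureReal_iUnion_le_tsum (fun R => ?_) hs
  rcases Nat.lt_or_ge R 1 with hR | hR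
  · have h0 : {ω | 1 ≤ R ∧ P R ω} = ∅ := by
      ext ω; simp only [Set.mem_setOf_eq, Set.mem_empty_iff_false, iff_false, not_and]; intro h; omega
    rw [h0, measureReal_empty]; exact hδ0 R
  · have h1 : {ω | 1 ≤ R ∧ P R ω} = {ω | P R ω} := by
      ext ω; simp only [Set.mem_setOf_eq, and_iff_right hR]
    rw [h1]; exact hP R hR

/-! ## §3 Anytime Hoeffding -/

variable [IsProbabilityMeasure μ] {X : ℕ → Ω' → ℝ}

/-- **ANYTIME HOEFFDING, TWO-SIDED, FOR RUNNING AVERAGES**: mutually independent measurable `X_j ∈ [a, b]` with a common mean `m`;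
radii `ε_R ≥ 0` and a summable risk schedule `δ_R ≥ 0` with `2·exp(−2Rε_R²/(b − a)²) ≤ δ_R` for every `R ≥ 1`:
`P(∃ R ≥ 1, |R⁻¹Σ_{j<R} X_j − m| ≥ ε_R) ≤ Σ_R δ_R` — the bar may be read at EVERY sample size at once. [ours] -/
theorem hoeffding_avg_abs_anytime (hXm : ∀ j, Measurable (X j)) (hind : iIndepFun X μ) {a b : ℝ}
    (hbd : ∀ j ω, X j ω ∈ Set.Icc a b) {m : ℝ} (hmean : ∀ j, μ[X j] = m) {ε δ : ℕ → ℝ} (hε : ∀ R, 0 ≤ ε R)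
    (hδ0 : ∀ R, 0 ≤ δ R) (hδ : ∀ R, 1 ≤ R → 2 * Real.exp (-(2 * R * ε R ^ 2) / (b - a) ^ 2) ≤ δ R) (hs : Summable δ) :
    μ.real {ω | ∃ R, 1 ≤ R ∧ ε R ≤ |(R : ℝ)⁻¹ * ∑ j ∈ range R, X j ω - m|} ≤ ∑' R, δ R :=
  measureReal_exists_ge_one_le_tsum hδ0
    (fun R hR => (hoeffding_avg_abs_of_mem_Icc hXm hind hbd hmean (hε R) hR).trans (hδ R hR)) hs

/-- **ANYTIME HOEFFDING, CALIBRATED**: with `a < b`, `δ > 0` and radii satisfying `(b − a)²·log(4(R + 1)(R + 2)/δ) ≤ 2Rε_R²` for every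
`R ≥ 1` (e.g. `ε_R = (b − a)·√(log(4(R + 1)(R + 2)/δ)/(2R))`): `P(∃ R ≥ 1, |R⁻¹Σ_{j<R} X_j − m| ≥ ε_R) ≤ δ/2`. [ours] -/
theorem hoeffding_avg_abs_anytime_of_log_le (hXm : ∀ j, Measurable (X j)) (hind : iIndepFun X μ) {a b : ℝ} (hab : a < b)
    (hbd : ∀ j ω, X j ω ∈ Set.Icc a b) {m : ℝ} (hmean : ∀ j, μ[X j] = m) {ε : ℕ → ℝ} (hε : ∀ R, 0 ≤ ε R) {δ : ℝ} (hδ : 0 < δ)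
    (hR : ∀ R : ℕ, 1 ≤ R → (b - a) ^ 2 * Real.log (4 * (((R : ℝ) + 1) * ((R : ℝ) + 2)) / δ) ≤ 2 * R * ε R ^ 2) :
    μ.real {ω | ∃ R, 1 ≤ R ∧ ε R ≤ |(R : ℝ)⁻¹ * ∑ j ∈ range R, X j ω - m|} ≤ δ / 2 := by
  have h := hoeffding_avg_abs_anytime hXm hind hbd hmean hε (δ := fun R => δ / (((R : ℝ) + 1) * ((R : ℝ) + 2)) / 2)
    (fun R => by have := schedule_nonneg hδ.le R; positivity) (fun R hR1 => ?_) ((summable_schedule δ).div_const 2)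
  · rwa [tsum_div_const, tsum_schedule] at h
  · have hlog : (b - a) ^ 2 * Real.log (4 / (δ / (((R : ℝ) + 1) * ((R : ℝ) + 2)))) ≤ 2 * R * ε R ^ 2 := by
      rw [four_div_schedule]; exact hR R hR1
    exact two_mul_exp_le_of_log_le hab (schedule_pos hδ R) hlog

/-- **ANYTIME HOEFFDING, UPPER TAIL**: `P(∃ R ≥ 1, R⁻¹Σ_{j<R} X_j − m ≥ ε_R) ≤ Σ_R δ_R` when `exp(−2Rε_R²/(b − a)²) ≤ δ_R` for
`R ≥ 1`. [ours] -/
theorem hoeffding_avg_ge_anytime (hXm : ∀ j, Measurable (X j)) (hind : iIndepFun X μ) {a b : ℝ}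
    (hbd : ∀ j ω, X j ω ∈ Set.Icc a b) {m : ℝ} (hmean : ∀ j, μ[X j] = m) {ε δ : ℕ → ℝ} (hε : ∀ R, 0 ≤ ε R)
    (hδ0 : ∀ R, 0 ≤ δ R) (hδ : ∀ R, 1 ≤ R → Real.exp (-(2 * R * ε R ^ 2) / (b - a) ^ 2) ≤ δ R) (hs : Summable δ) :
    μ.real {ω | ∃ R, 1 ≤ R ∧ ε R ≤ (R : ℝ)⁻¹ * ∑ j ∈ range R, X j ω - m} ≤ ∑' R, δ R :=
  measureReal_exists_ge_one_le_tsum hδ0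
    (fun R hR => (hoeffding_avg_ge_of_mem_Icc hXm hind hbd hmean (hε R) hR).trans (hδ R hR)) hs

/-- **ANYTIME HOEFFDING, LOWER TAIL**: `P(∃ R ≥ 1, m − R⁻¹Σ_{j<R} X_j ≥ ε_R) ≤ Σ_R δ_R` when `exp(−2Rε_R²/(b − a)²) ≤ δ_R` for
`R ≥ 1`. [ours] -/
theorem hoeffding_avg_le_anytime (hXm : ∀ j, Measurable (X j)) (hind : iIndepFun X μ) {a b : ℝ}
    (hbd : ∀ j ω, X j ω ∈ Set.Icc a b) {m : ℝ} (hmean : ∀ j, μ[X j] = m) {ε δ : ℕ → ℝ} (hε : ∀ R, 0 ≤ ε R)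
    (hδ0 : ∀ R, 0 ≤ δ R) (hδ : ∀ R, 1 ≤ R → Real.exp (-(2 * R * ε R ^ 2) / (b - a) ^ 2) ≤ δ R) (hs : Summable δ) :
    μ.real {ω | ∃ R, 1 ≤ R ∧ ε R ≤ m - (R : ℝ)⁻¹ * ∑ j ∈ range R, X j ω} ≤ ∑' R, δ R :=
  measureReal_exists_ge_one_le_tsum hδ0
    (fun R hR => (hoeffding_avg_le_of_mem_Icc hXm hind hbd hmean (hε R) hR).trans (hδ R hR)) hs

/-! ## §4 Anytime Bernstein -/

/-- **ANYTIME BERNSTEIN, TWO-SIDED, FOR RUNNING AVERAGES**: mutually independent measurable `X_j` with a common mean `m`,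
`|X_j − m| ≤ b`, `Var X_j ≤ σ²` (`σ² > 0`); radii `ε_R ≥ 0` and a summable risk schedule `δ_R ≥ 0` with
`2·exp(−Rε_R²/(2(σ² + bε_R/3))) ≤ δ_R` for every `R ≥ 1`: `P(∃ R ≥ 1, |R⁻¹Σ_{j<R} X_j − m| ≥ ε_R) ≤ Σ_R δ_R`. [ours] -/
theorem bernstein_avg_abs_anytime (hXm : ∀ j, Measurable (X j)) (hind : iIndepFun X μ) {b : ℝ} {m : ℝ}
    (hmean : ∀ j, μ[X j] = m) (hbd : ∀ j ω, |X j ω - m| ≤ b) {σ2 : ℝ} (hσ : 0 < σ2) (hvar : ∀ j, variance (X j) μ ≤ σ2)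
    {ε δ : ℕ → ℝ} (hε : ∀ R, 0 ≤ ε R) (hδ0 : ∀ R, 0 ≤ δ R)
    (hδ : ∀ R, 1 ≤ R → 2 * Real.exp (-(R * ε R ^ 2) / (2 * (σ2 + b * ε R / 3))) ≤ δ R) (hs : Summable δ) :
    μ.real {ω | ∃ R, 1 ≤ R ∧ ε R ≤ |(R : ℝ)⁻¹ * ∑ j ∈ range R, X j ω - m|} ≤ ∑' R, δ R :=
  measureReal_exists_ge_one_le_tsum hδ0
    (fun R hR => (bernstein_avg_abs hXm hind hmean hbd hσ hvar (hε R) hR).trans (hδ R hR)) hs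

/-- **ANYTIME BERNSTEIN, CALIBRATED**: with `b ≥ 0`, `δ > 0` and radii satisfying `2(σ² + bε_R/3)·log(4(R + 1)(R + 2)/δ) ≤ Rε_R²`
for every `R ≥ 1`: `P(∃ R ≥ 1, |R⁻¹Σ_{j<R} X_j − m| ≥ ε_R) ≤ δ/2`. [ours] -/
theorem bernstein_avg_abs_anytime_of_log_le (hXm : ∀ j, Measurable (X j)) (hind : iIndepFun X μ) {b : ℝ} (hb : 0 ≤ b) {m : ℝ}
    (hmean : ∀ j, μ[X j] = m) (hbd : ∀ j ω, |X j ω - m| ≤ b) {σ2 : ℝ} (hσ : 0 < σ2) (hvar : ∀ j, variance (X j) μ ≤ σ2)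
    {ε : ℕ → ℝ} (hε : ∀ R, 0 ≤ ε R) {δ : ℝ} (hδ : 0 < δ)
    (hR : ∀ R : ℕ, 1 ≤ R → 2 * (σ2 + b * ε R / 3) * Real.log (4 * (((R : ℝ) + 1) * ((R : ℝ) + 2)) / δ) ≤ R * ε R ^ 2) :
    μ.real {ω | ∃ R, 1 ≤ R ∧ ε R ≤ |(R : ℝ)⁻¹ * ∑ j ∈ range R, X j ω - m|} ≤ δ / 2 := by
  have h := bernstein_avg_abs_anytime hXm hind hmean hbd hσ hvar hε (δ := fun R => δ / (((R : ℝ) + 1) * ((R : ℝ) + 2)) / 2)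
    (fun R => by have := schedule_nonneg hδ.le R; positivity) (fun R hR1 => ?_) ((summable_schedule δ).div_const 2)
  · rwa [tsum_div_const, tsum_schedule] at h
  · have hD : 0 < σ2 + b * ε R / 3 := by have := mul_nonneg hb (hε R); positivity
    have hlog : 2 * (σ2 + b * ε R / 3) * Real.log (4 / (δ / (((R : ℝ) + 1) * ((R : ℝ) + 2)))) ≤ R * ε R ^ 2 := by
      rw [four_div_schedule]; exact hR R hR1
    exact two_mul_exp_bernstein_le_of_log_le hD (schedule_pos hδ R) hlog

end Generic

end Summit.Ventures.LatticeQCDFlow.Exactness
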